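import Summits.Schanuel.Schanuel.Theorems.RootDecomp1KGeneric04
import Mathlib.Analysis.SpecificLimits.Normed

/-!
# RootDecomp1K — «GENERIC CELLS», part 05: CF step (i)(a)(b) — specialised relations and their root package

Piece CF (`CylinderFunnel`, part 01) is PROVED in parts 05–07 (lens 6, gen 13, addendum CFEndgame v4).
This part: for an integer relation `Σ_k G_k(ρ) w^k = 0` (`G_K ≠ 0`, `ρ` real transcendental) and a rational
`p/q` close to `ρ`, the SPECIALISED integer polynomial `specY G D p q = Σ_k (q^D G_k(p/q)) Y^k ∈ ℤ[Y]`
(`scaleEval`), its coefficient / degree / leading-coefficient bookkeeping (`abs_coeff_specY_le`,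
`natDegree_specY_eq`, `scaleEval_ne_zero` via the tree's `denBound`), a Cauchy root bound
(`norm_root_le_of_abs_coeff_le`), and the ROOT PACKAGE `root_package`: a root `y` of `specY G D p q` with
`‖w − y‖^K ≤ q^D · Λ · |ρ − p/q|` (`Λ` a local Lipschitz constant of `sliceAt G w` at `ρ`), plus `root_bounds`.
Hypothesis-free; sorry-free; standard axioms; rung 0.
-/

noncomputable section

open Complex Polynomial

namespace Summit.Schanuel.Schanuel.Theorems.RootDecomp1KGeneric

open Summit.Schanuel.Schanuel.Theorems.RootDecomp1KHyper
open Summit.Schanuel.Schanuel.Theorems.RootDecomp1KHyper.HyperCell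

section StepOne

/-! ## CF step (i), part (a): elementary inequalities -/


/-- `‖a^n − b^n‖ ≤ n · max(1, ‖a‖, ‖b‖)^n · ‖a − b‖`. -/
theorem norm_pow_sub_pow_le (a b : ℂ) (n : ℕ) :
    ‖a ^ n - b ^ n‖ ≤ n * (max 1 (max ‖a‖ ‖b‖)) ^ n * ‖a - b‖ := by
  set M := max 1 (max ‖a‖ ‖b‖) with hM
  have hM1 : 1 ≤ M := le_max_left _ _
  have haM : ‖a‖ ≤ M := (le_max_left _ _).trans (le_max_right _ _)
  have hbM : ‖b‖ ≤ M := (le_max_right _ _).trans (le_max_right _ _)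
  induction n with
  | zero => simp
  | succ n ih =>
    have hsplit : a ^ (n + 1) - b ^ (n + 1) = a * (a ^ n - b ^ n) + (a - b) * b ^ n := by ring
    rw [hsplit]
    calc ‖a * (a ^ n - b ^ n) + (a - b) * b ^ n‖
        ≤ ‖a‖ * ‖a ^ n - b ^ n‖ + ‖a - b‖ * ‖b‖ ^ n := by
          refine (norm_add_le _ _).trans ?_
          rw [norm_mul, norm_mul, norm_pow]
      _ ≤ M * (n * M ^ n * ‖a - b‖) + ‖a - b‖ * M ^ n := by
          gcongr
      _ ≤ M * (n * M ^ n * ‖a - b‖) + ‖a - b‖ * (M ^ n * M) := by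
          gcongr
          exact le_mul_of_one_le_right (pow_nonneg (by linarith) _) hM1
      _ = ((n + 1 : ℕ) : ℝ) * M ^ (n + 1) * ‖a - b‖ := by push_cast; ring

/-- `q^D · g(p/q)` as an integer, for `deg g ≤ D`. -/
def scaleEval (g : ℤ[X]) (D : ℕ) (p : ℤ) (q : ℕ) : ℤ :=
  ∑ i ∈ Finset.range (D + 1), g.coeff i * p ^ i * (q : ℤ) ^ (D - i)

/-- Cast of `scaleEval g D p q` to a characteristic-zero field: `q^D · g(p/q)`. -/
theorem scaleEval_cast {F : Type*} [Field F] [CharZero F] (g : ℤ[X]) {D : ℕ}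
    (hg : g.natDegree ≤ D) (p : ℤ) {q : ℕ} (hq : q ≠ 0) :
    ((scaleEval g D p q : ℤ) : F) = (q : F) ^ D * aeval ((p : F) / q) g := by
  rw [aeval_eq_sum_range' (Nat.lt_succ_of_le hg), scaleEval]
  simp only [zsmul_eq_mul]
  push_cast
  rw [Finset.mul_sum]
  refine Finset.sum_congr rfl fun i hi => ?_
  have hi' : i ≤ D := Nat.lt_succ_iff.mp (Finset.mem_range.mp hi)
  have hqF : (q : F) ≠ 0 := by exact_mod_cast hq
  have hsplit : (q : F) ^ D = (q : F) ^ i * (q : F) ^ (D - i) := by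
    rw [← pow_add, Nat.add_sub_cancel' hi']
  rw [hsplit, div_pow]
  field_simp

/-- The ℓ¹-length `len g` as a sum of `|coeff|` over `range (D+1)` for `deg g ≤ D`. -/
theorem sum_range_abs_coeff_eq_len (g : ℤ[X]) {D : ℕ} (hg : g.natDegree ≤ D) :
    ∑ i ∈ Finset.range (D + 1), |g.coeff i| = len g := by
  rw [len]
  symm
  have hsub : Finset.range (g.natDegree + 1) ⊆ Finset.range (D + 1) := fun x hx =>
    Finset.mem_range.mpr (lt_of_lt_of_le (Finset.mem_range.mp hx) (Nat.succ_le_succ hg))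
  refine Finset.sum_subset hsub fun i hi hni => ?_
  have h1 : i < D + 1 := Finset.mem_range.mp hi
  have h2 : ¬ i < g.natDegree + 1 := fun h => hni (Finset.mem_range.mpr h)
  have : g.natDegree < i := by omega
  rw [coeff_eq_zero_of_natDegree_lt this, abs_zero]

/-- Size bound `|scaleEval g D p q| ≤ len g · (|p| + q)^D`. -/
theorem abs_scaleEval_le (g : ℤ[X]) {D : ℕ} (hg : g.natDegree ≤ D) (p : ℤ) (q : ℕ) :
    |scaleEval g D p q| ≤ len g * (|p| + q) ^ D := by
  rw [scaleEval, ← sum_range_abs_coeff_eq_len g hg, Finset.sum_mul]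
  refine (Finset.abs_sum_le_sum_abs _ _).trans (Finset.sum_le_sum fun i hi => ?_)
  have hi' : i ≤ D := Nat.lt_succ_iff.mp (Finset.mem_range.mp hi)
  have hq' : |(q : ℤ)| = q := abs_of_nonneg (Int.natCast_nonneg q)
  simp only [abs_mul, abs_pow, hq']
  rw [mul_assoc]
  refine mul_le_mul_of_nonneg_left ?_ (abs_nonneg _)
  calc |p| ^ i * (q : ℤ) ^ (D - i) ≤ (|p| + q) ^ i * (|p| + q) ^ (D - i) := by
        gcongr
        · exact le_add_of_nonneg_right (by positivity)
        · exact le_add_of_nonneg_left (abs_nonneg p)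
    _ = (|p| + q) ^ D := by rw [← pow_add, Nat.add_sub_cancel' hi']

variable {K : ℕ}

/-- The specialised relation `A_q(Y) = Σ_k q^D G_k(p/q) · Y^k ∈ ℤ[Y]`. -/
def specY (G : Fin (K + 1) → ℤ[X]) (D : ℕ) (p : ℤ) (q : ℕ) : ℤ[X] :=
  ∑ k : Fin (K + 1), C (scaleEval (G k) D p q) * X ^ (k : ℕ)

/-- The `k`-th coefficient of the specialised relation `specY G D p q` is `scaleEval (G k) D p q`. -/
theorem coeff_specY (G : Fin (K + 1) → ℤ[X]) (D : ℕ) (p : ℤ) (q : ℕ) (k : Fin (K + 1)) :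
    (specY G D p q).coeff (k : ℕ) = scaleEval (G k) D p q := by
  unfold specY
  rw [finsetSum_coeff]
  simp only [coeff_C_mul, coeff_X_pow]
  rw [Finset.sum_eq_single k]
  · simp
  · intro j _ hjk
    rw [if_neg]; · simp
    intro h; exact hjk (Fin.ext h.symm)
  · intro h; exact absurd (Finset.mem_univ k) h

/-- `specY G D p q` has no coefficients above `K`. -/
theorem coeff_specY_eq_zero (G : Fin (K + 1) → ℤ[X]) (D : ℕ) (p : ℤ) (q : ℕ) {j : ℕ} (hj : K < j) :
    (specY G D p q).coeff j = 0 := by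
  unfold specY
  rw [finsetSum_coeff]
  refine Finset.sum_eq_zero fun k _ => ?_
  simp only [coeff_C_mul, coeff_X_pow]
  rw [if_neg, mul_zero]
  have := k.2; omega

/-- `deg (specY G D p q) ≤ K`. -/
theorem natDegree_specY_le (G : Fin (K + 1) → ℤ[X]) (D : ℕ) (p : ℤ) (q : ℕ) :
    (specY G D p q).natDegree ≤ K := by
  unfold specY
  refine natDegree_sum_le_of_forall_le _ _ fun k _ => ?_
  refine (natDegree_C_mul_le _ _).trans ?_
  rw [natDegree_X_pow]
  exact Nat.lt_succ_iff.mp k.2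

/-- Coefficient bound `|coeff_j (specY G D p q)| ≤ relLen G · (|p| + q)^D`. -/
theorem abs_coeff_specY_le (G : Fin (K + 1) → ℤ[X]) {D : ℕ} (hD : ∀ k, (G k).natDegree ≤ D)
    (p : ℤ) (q : ℕ) (j : ℕ) :
    (|(specY G D p q).coeff j| : ℝ) ≤ relLen G * ((|p| : ℝ) + q) ^ D := by
  by_cases hj : j ≤ K
  · set k : Fin (K + 1) := ⟨j, Nat.lt_succ_of_le hj⟩
    have hkj : (k : ℕ) = j := rfl
    rw [← hkj, coeff_specY]
    have h1 := abs_scaleEval_le (G k) (hD k) p q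
    have h2 : ((|scaleEval (G k) D p q| : ℤ) : ℝ) ≤ ((len (G k) * (|p| + q) ^ D : ℤ) : ℝ) := by
      exact_mod_cast h1
    push_cast at h2
    refine h2.trans (mul_le_mul_of_nonneg_right ?_ (by positivity))
    rw [relLen]
    exact Finset.single_le_sum (f := fun k => (len (G k) : ℝ)) (fun i _ => by exact_mod_cast len_nonneg _)
      (Finset.mem_univ k)
  · rw [coeff_specY_eq_zero G D p q (not_le.mp hj)]
    simp only [Int.cast_zero, abs_zero]
    exact mul_nonneg (relLen_nonneg G) (by positivity)

/-- Evaluation of the specialised relation: `specY G D p q (y) = q^D · Σ_k G_k(p/q) y^k`. -/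
theorem aeval_specY (G : Fin (K + 1) → ℤ[X]) {D : ℕ} (hD : ∀ k, (G k).natDegree ≤ D) (p : ℤ)
    {q : ℕ} (hq : q ≠ 0) (y : ℂ) :
    aeval y (specY G D p q) = (q : ℂ) ^ D * ∑ k : Fin (K + 1), aeval ((p : ℂ) / q) (G k) * y ^ (k : ℕ) := by
  unfold specY
  rw [map_sum, Finset.mul_sum]
  refine Finset.sum_congr rfl fun k _ => ?_
  rw [map_mul, map_pow, aeval_X, aeval_C, algebraMap_int_eq, eq_intCast,
    scaleEval_cast (G k) (hD k) p hq]
  ring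

/-- The leading coefficient of `A_q` is `q^D G_K(p/q)`, non-zero once `G_K(p/q) ≠ 0`. -/
theorem natDegree_specY_eq (G : Fin (K + 1) → ℤ[X]) (D : ℕ) (p : ℤ) (q : ℕ)
    (h : scaleEval (G (Fin.last K)) D p q ≠ 0) : (specY G D p q).natDegree = K := by
  refine le_antisymm (natDegree_specY_le G D p q) (le_natDegree_of_ne_zero ?_)
  have := coeff_specY G D p q (Fin.last K)
  rw [Fin.val_last] at this
  rwa [this]

/-- The leading coefficient of `specY G D p q` is `scaleEval (G (Fin.last K)) D p q` when the latter is non-zero. -/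
theorem leadingCoeff_specY (G : Fin (K + 1) → ℤ[X]) (D : ℕ) (p : ℤ) (q : ℕ)
    (h : scaleEval (G (Fin.last K)) D p q ≠ 0) :
    (specY G D p q).leadingCoeff = scaleEval (G (Fin.last K)) D p q := by
  rw [leadingCoeff, natDegree_specY_eq G D p q h]
  have := coeff_specY G D p q (Fin.last K)
  rwa [Fin.val_last] at this

/-- `specY G D p q ≠ 0` when its top coefficient `scaleEval (G (Fin.last K)) D p q` is non-zero. -/
theorem specY_ne_zero (G : Fin (K + 1) → ℤ[X]) (D : ℕ) (p : ℤ) (q : ℕ)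
    (h : scaleEval (G (Fin.last K)) D p q ≠ 0) : specY G D p q ≠ 0 := by
  intro h0
  have := leadingCoeff_specY G D p q h
  rw [h0, leadingCoeff_zero] at this
  exact h this.symm

/-- Non-vanishing of the top coefficient along reduced fractions with large denominator. -/
theorem scaleEval_ne_zero {g : ℤ[X]} (hg : g ≠ 0) {D : ℕ} (hgD : g.natDegree ≤ D) (r : ℚ)
    (hden : denBound g ≤ r.den) : scaleEval g D r.num r.den ≠ 0 := by
  intro h0
  have h1 := scaleEval_cast (F := ℚ) g hgD r.num r.den_nz
  rw [h0, Int.cast_zero, eq_comm, mul_eq_zero] at h1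
  have hq : (r.den : ℚ) ^ D ≠ 0 := pow_ne_zero _ (by exact_mod_cast r.den_nz)
  have h2 : aeval ((r.num : ℚ) / r.den) g = 0 := (or_iff_right hq).mp h1
  rw [Rat.num_div_den r] at h2
  have := den_lt_denBound hg h2
  omega

/-- **Cauchy's bound for integer polynomials**: all complex roots of `A ≠ 0` have modulus
`≤ (deg A + 1) · M` when every coefficient is `≤ M` in absolute value (`|lc A| ≥ 1`). -/
theorem norm_root_le_of_abs_coeff_le {A : ℤ[X]} (hA : A ≠ 0) {M : ℝ}
    (hM : ∀ j, (|A.coeff j| : ℝ) ≤ M) {z : ℂ} (hz : z ∈ A.aroots ℂ) :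
    ‖z‖ ≤ (A.natDegree + 1) * M := by
  have hM1 : 1 ≤ M := by
    have h := hM A.natDegree
    have hlc : (1 : ℝ) ≤ |(A.coeff A.natDegree : ℝ)| := by
      rw [← Int.cast_abs]; exact_mod_cast Int.one_le_abs (leadingCoeff_ne_zero.mpr hA)
    exact hlc.trans h
  have hroot : aeval z A = 0 := (mem_aroots.mp hz).2
  by_cases hz1 : ‖z‖ ≤ 1
  · calc ‖z‖ ≤ 1 := hz1
      _ ≤ (A.natDegree + 1) * M := by nlinarith [A.natDegree.cast_nonneg (α := ℝ)]
  have hz1' : 1 < ‖z‖ := not_le.mp hz1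
  set N := A.natDegree with hN
  have hN0 : 0 < N := by
    rcases Nat.eq_zero_or_pos N with h | h
    · exfalso
      have hdeg : A.natDegree = 0 := h
      rw [eq_C_of_natDegree_eq_zero hdeg, aeval_C, algebraMap_int_eq, eq_intCast, Int.cast_eq_zero] at hroot
      apply hA
      rw [eq_C_of_natDegree_eq_zero hdeg, hroot, C_0]
    · exact h
  -- the relation  lc · z^N = − Σ_{j<N} a_j z^j
  have hsum : aeval z A = ∑ j ∈ Finset.range (N + 1), (A.coeff j : ℂ) * z ^ j := by
    rw [aeval_eq_sum_range]
    simp only [zsmul_eq_mul, ← hN]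
  rw [hroot, Finset.sum_range_succ] at hsum
  have hlead : (A.coeff N : ℂ) * z ^ N = -∑ j ∈ Finset.range N, (A.coeff j : ℂ) * z ^ j := by
    linear_combination -hsum
  have hlc1 : (1 : ℝ) ≤ ‖(A.coeff N : ℂ)‖ := by
    rw [Complex.norm_intCast]; exact_mod_cast Int.one_le_abs (leadingCoeff_ne_zero.mpr hA)
  have hbound : ‖z‖ ^ N ≤ (N * M) * ‖z‖ ^ (N - 1) := by
    calc ‖z‖ ^ N = 1 * ‖z‖ ^ N := (one_mul _).symm
      _ ≤ ‖(A.coeff N : ℂ)‖ * ‖z‖ ^ N := by gcongr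
      _ = ‖∑ j ∈ Finset.range N, (A.coeff j : ℂ) * z ^ j‖ := by
          rw [← norm_pow, ← norm_mul, hlead, norm_neg]
      _ ≤ ∑ j ∈ Finset.range N, ‖(A.coeff j : ℂ) * z ^ j‖ := norm_sum_le _ _
      _ ≤ ∑ j ∈ Finset.range N, M * ‖z‖ ^ (N - 1) := by
          refine Finset.sum_le_sum fun j hj => ?_
          have hj' : j ≤ N - 1 := by have := Finset.mem_range.mp hj; omega
          rw [norm_mul, norm_pow, Complex.norm_intCast]
          exact mul_le_mul (hM j) (pow_le_pow_right₀ hz1'.le hj') (by positivity)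
            (by linarith)
      _ = (N * M) * ‖z‖ ^ (N - 1) := by rw [Finset.sum_const, Finset.card_range]; ring
  have hzpos : 0 < ‖z‖ ^ (N - 1) := pow_pos (by linarith) _
  have hzN : ‖z‖ ^ N = ‖z‖ * ‖z‖ ^ (N - 1) := by
    rw [← pow_succ', Nat.sub_add_cancel hN0]
  rw [hzN] at hbound
  have : ‖z‖ ≤ N * M := le_of_mul_le_mul_right hbound hzpos
  calc ‖z‖ ≤ N * M := this
    _ ≤ (N + 1) * M := by nlinarith

/-! ## CF step (i), part (b): the root package of one specialised relation -/

/-- A relation `Σ_k G_k(a) w^k = 0` with `G_K ≠ 0` and `a` transcendental has `K ≥ 1`. -/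
theorem relation_degree_pos {a w : ℂ} (ha : Transcendental ℚ a) {G : Fin (K + 1) → ℤ[X]}
    (hGK : G (Fin.last K) ≠ 0) (hrel : ∑ k : Fin (K + 1), aeval a (G k) * w ^ (k : ℕ) = 0) :
    0 < K := by
  rcases Nat.eq_zero_or_pos K with h | h
  · subst h
    rw [Fin.sum_univ_one] at hrel
    simp only [Fin.isValue, Fin.val_zero, pow_zero, mul_one] at hrel
    exact absurd (isAlgebraic_of_aeval_int hGK hrel) ha
  · exact h

/-- A rational number cast to `ℂ` (through `ℝ`) equals `num / den`. -/
theorem ratCast_eq_num_div_den (r : ℚ) : ((r : ℝ) : ℂ) = ((r.num : ℤ) : ℂ) / ((r.den : ℕ) : ℂ) := by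
  rw [Complex.ofReal_ratCast, Rat.cast_def]

/-- **Root package.**  For a relation `Σ_k G_k(ρ) w^k = 0` (`G_K ≠ 0`, `K ≥ 1`, `deg G_k ≤ D`), a
Lipschitz constant `Λ` of `x ↦ Σ_k G_k(x) w^k` near `ρ`, and a fraction `r = p/q` in lowest terms with
`q ≥ denBound G_K`, `|ρ − r| ≤ 1`: the specialised polynomial `A_q = specY G D p q ∈ ℤ[Y]` is non-zero
of degree exactly `K`, and has a root `y` with `‖w − y‖^K ≤ q^D · Λ · |ρ − r|`. -/
theorem root_package (G : Fin (K + 1) → ℤ[X]) (hK : 0 < K) (hGK : G (Fin.last K) ≠ 0)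
    {D : ℕ} (hD : ∀ k, (G k).natDegree ≤ D) {ρ : ℝ} {w : ℂ}
    (hrel : ∑ k : Fin (K + 1), aeval (ρ : ℂ) (G k) * w ^ (k : ℕ) = 0)
    {Λ : ℝ} (hΛ : ∀ z : ℂ, ‖z - (ρ : ℂ)‖ ≤ 1 →
      ‖(sliceAt G w).eval z - (sliceAt G w).eval (ρ : ℂ)‖ ≤ Λ * ‖z - (ρ : ℂ)‖)
    (r : ℚ) (hden : denBound (G (Fin.last K)) ≤ r.den) (hr1 : |ρ - r| ≤ 1) :
    specY G D r.num r.den ≠ 0 ∧ (specY G D r.num r.den).natDegree = K ∧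
      ∃ y : ℂ, aeval y (specY G D r.num r.den) = 0 ∧
        ‖w - y‖ ^ K ≤ (r.den : ℝ) ^ D * Λ * |ρ - r| := by
  have h0 : scaleEval (G (Fin.last K)) D r.num r.den ≠ 0 := scaleEval_ne_zero hGK (hD _) r hden
  have hA0 := specY_ne_zero G D r.num r.den h0
  have hdeg := natDegree_specY_eq G D r.num r.den h0
  refine ⟨hA0, hdeg, ?_⟩
  obtain ⟨y, hy, hle⟩ := exists_root_int_pow_le (specY G D r.num r.den) (by rw [hdeg]; exact hK) w
  refine ⟨y, hy, ?_⟩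
  rw [hdeg] at hle
  refine hle.trans ?_
  rw [aeval_specY G hD r.num r.den_nz w, ← eval_sliceAt, norm_mul, Complex.norm_pow,
    Complex.norm_natCast]
  have hρ0 : (sliceAt G w).eval (ρ : ℂ) = 0 := by rw [eval_sliceAt]; exact hrel
  have hpq : ((r.num : ℤ) : ℂ) / ((r.den : ℕ) : ℂ) = ((r : ℝ) : ℂ) := (ratCast_eq_num_div_den r).symm
  have hdist : ‖(((r : ℝ) : ℂ)) - (ρ : ℂ)‖ = |ρ - r| := by
    rw [← Complex.ofReal_sub, Complex.norm_real, Real.norm_eq_abs, abs_sub_comm]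
  have h1 := hΛ ((r : ℝ) : ℂ) (by rw [hdist]; exact hr1)
  rw [hρ0, sub_zero, hdist] at h1
  rw [hpq, mul_assoc]
  exact mul_le_mul_of_nonneg_left h1 (by positivity)

/-- Coefficient and root bounds of the specialised polynomial. -/
theorem root_bounds (G : Fin (K + 1) → ℤ[X]) {D : ℕ} (hD : ∀ k, (G k).natDegree ≤ D) (p : ℤ) (q : ℕ)
    (hA0 : specY G D p q ≠ 0) (hdeg : (specY G D p q).natDegree = K) :
    (((specY G D p q).leadingCoeff.natAbs : ℕ) : ℝ) ≤ relLen G * ((|p| : ℝ) + q) ^ D ∧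
    ∀ z ∈ (specY G D p q).aroots ℂ, ‖z‖ ≤ (K + 1) * (relLen G * ((|p| : ℝ) + q) ^ D) := by
  refine ⟨?_, fun z hz => ?_⟩
  · rw [Nat.cast_natAbs, Int.cast_abs, leadingCoeff]
    exact abs_coeff_specY_le G hD p q _
  · have := norm_root_le_of_abs_coeff_le hA0 (abs_coeff_specY_le G hD p q) hz
    rwa [hdeg] at this

end StepOne

end Summit.Schanuel.Schanuel.Theorems.RootDecomp1KGeneric
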